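import Summits.BirchSwinnertonDyer.BirchSwinnertonDyer.Theorems.ManinLocalTwoThreeKLineThreeBoundedK
import Summits.BirchSwinnertonDyer.BirchSwinnertonDyer.Theorems.ManinLocalTwoThreeKLineComponentsBoundedSplit
import HarnessLib

/-!
# (BI)_K HOLDS: the split case (`Y₀² ∈ (ℚ₃ˣ)²`, including `Y₀ ∈ ℚ`) and -an's `KummerCubeRootThreeBoundedK` BY NAME
(route `ManinLocalTwoThree`, crux C3 `ManinPrimeToThreeAtNine` stmt-BirchSwinnertonDyer-22968 — residual RES₃♭, -an g39's `K`-line; C3 LEAD's skeleton v30 stub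
(BI)_K `stub_kummerCubeRootThreeBoundedK : KummerCubeRootThreeBoundedK`; cell bsd-f2-manin, prover seat p2 gen 18; `--supports stmt-BirchSwinnertonDyer-22968`)

* `kummerCubeRootThreeBoundedK_of_isSquare_padic` — the binders of (BI)_K plus «`Y₀² = X₀³ + a₄X₀ + a₆` IS a square in `ℚ₃`» ⟹ the conclusion of
  (BI)_K.  Same assembly as the non-split file `…KLineThreeBoundedK` (P4, p739974: normalisation `Y₀ = 3^m Y`, `Y² = r₃`; a cube root over
  `ℚ[ω]/(ω² = r₃)` by the binomial series read in components `u, v` through P1; `h := u + Y·v`; the `3`-adic transport P2 and the point/slope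
  bookkeeping), with the SPLIT core `KLineBI.components_threeAdicallyBounded_split` (P5: the two `ℚ₃`-points `(X₁, ±ys)`, `s² = r₃`, `s ∈ ℤ₃ˣ` because
  `r₃ = 3^{t₀}r₀` is a square) in place of P3.
* **`kummerCubeRootThreeBoundedK_holds : UDCKummerLineK.KummerCubeRootThreeBoundedK`** — (BI)_K, by cases on «square in `ℚ₃`» (this file + P4).
* `stub_kummerCubeRootThreeBoundedK` — the C3 LEAD's v30 stub header, verbatim.

HONEST FRAMING.  (BI)_K is now a theorem; KLINE still needs (AN♮)_K ∘ (INT)_K in the tree (p3's p737513/p737534, held by the hub's missing olean of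
`…CubeRootComponents`) and UDW-algInt (the printed CDT fact); RES₃♭, C3, Manin's conjecture and BSD are NOT proved.  No definitions, no sorry, no new
axioms. [cite: Honda1970, Thm. 2 (p. 223)] [cite: Washington1997, Thm. 7.3 and §7.1 (shape)] [cite: SilvermanAEC2009, Exercise 3.7(d) and III.2.3 (shape)]
-/

set_option autoImplicit false
-- lint-debt: the directory name repeats the summit name (sibling precedent `ManinLocalTwoThreeKLineThreeBoundedK.lean`)
set_option linter.dupNamespace false

noncomputable section

open scoped Classical QuadraticAlgebra
open PowerSeries WeierstrassCurve Literature.NumberTheory.EllipticCurves Literature.NumberTheory.EllipticCurves.ModularForms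
open Summit.BirchSwinnertonDyer.Rank1Residual.ManinAdditive.CuspidalKummer
  Summit.BirchSwinnertonDyer.Rank1Residual.ManinAdditive.CuspidalKummerThree
  Summit.BirchSwinnertonDyer.Rank1Residual.ManinAdditive.UDCKummerLineK

namespace Summit.BirchSwinnertonDyer.BirchSwinnertonDyer.Theorems.ManinLocalTwoThree.KLineBI

/-- **(BI)_K, split case.**  See the file header. [folklore] -/
theorem kummerCubeRootThreeBoundedK_of_isSquare_padic
    (W : WeierstrassCurve ℚ) [W.IsElliptic] [W.IsGloballyMinimal] {N : ℕ} [NeZero N]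
    (D : ModularParametrizationData W N) (a : ℕ → ℤ) (ha : ∀ n, (a n : ℂ) = cuspCoeff D.f n) (h9 : 9 ∣ N)
    (X₀ : ℚ) (Y₀ : ℂ) (hT : IsShortThreeTorsionC W D.c X₀ Y₀) (z : ℚ⟦X⟧) (hz : IsParamGerm W D.c a z) (h3c : (3 : ℤ) ∣ D.c)
    (hsq : ∃ s₀ : ℚ_[3], s₀ ^ 2 = ((X₀ ^ 3 + (shortModel W D.c).a₄ * X₀ + (shortModel W D.c).a₆ : ℚ) : ℚ_[3])) :
    ∃ h : ℂ⟦X⟧, h ^ 3 = kummerCubeSeriesC W D.c X₀ Y₀ z ∧ constantCoeff h = -1 ∧ IsThreeAdicallyBoundedAlg h := by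
  have h3n : ‖(3 : ℚ_[3])‖ < 1 := by simpa using Padic.norm_p_lt_one (p := 3)
  -- §0 the square `r = Y₀² ∈ ℚ`
  obtain ⟨r, hrdef⟩ : ∃ r : ℚ, r = X₀ ^ 3 + (shortModel W D.c).a₄ * X₀ + (shortModel W D.c).a₆ := ⟨_, rfl⟩
  rw [← hrdef] at hsq
  obtain ⟨s₀, hs₀⟩ := hsq
  have hY₀sq : Y₀ ^ 2 = (r : ℂ) := by
    rw [MinimalThreeTorsionC.equation_of_isShortThreeTorsionC hT, hrdef]; push_cast; ring
  have hY₀0 : Y₀ ≠ 0 := MinimalThreeTorsionC.y_ne_zero hT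
  have hrC : (r : ℂ) ≠ 0 := by rw [← hY₀sq]; exact pow_ne_zero 2 hY₀0
  have hr0 : r ≠ 0 := fun h0 => hrC (by rw [h0, Rat.cast_zero])
  have hr3 : (r : ℚ_[3]) ≠ 0 := by exact_mod_cast hr0
  -- §1 normalisation `Y₀ = 3^m·Y`, `Y² = r₃ := r/3^{2m} = 3^{t₀} r₀` in `ℚ₃`
  obtain ⟨m, t₀, r₀, ht₀, hr₀, hr₃⟩ := exists_threeAdic_normalisation r hr3
  obtain ⟨r₃, hr₃def⟩ : ∃ r₃ : ℚ, r₃ = r / (3 : ℚ) ^ (2 * m) := ⟨_, rfl⟩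
  rw [← hr₃def] at hr₃
  have h3Q : (3 : ℚ) ^ m ≠ 0 := zpow_ne_zero m (by norm_num)
  have h2m : (3 : ℚ) ^ (2 * m) = ((3 : ℚ) ^ m) ^ 2 := by rw [mul_comm, zpow_mul, zpow_two, ← pow_two]
  have hr₃r : r = ((3 : ℚ) ^ m) ^ 2 * r₃ := by
    rw [hr₃def, h2m, ← mul_div_assoc, mul_div_cancel_left₀ _ (pow_ne_zero 2 h3Q)]
  obtain ⟨Y, hYdef⟩ : ∃ Y : ℂ, Y = Y₀ / (((3 : ℚ) ^ m : ℚ) : ℂ) := ⟨_, rfl⟩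
  have h3C : (((3 : ℚ) ^ m : ℚ) : ℂ) ≠ 0 := by exact_mod_cast h3Q
  have hY₀Y : Y₀ = (((3 : ℚ) ^ m : ℚ) : ℂ) * Y := by rw [hYdef, mul_div_assoc', mul_div_cancel_left₀ _ h3C]
  have hYsq : Y ^ 2 = (r₃ : ℂ) := by
    rw [hYdef, div_pow, hY₀sq, hr₃r, Rat.cast_mul, Rat.cast_pow, mul_div_cancel_left₀ _ (pow_ne_zero 2 h3C)]
  -- the split datum `s = s₀/3^m`: `s² = r₃`, and `s ∈ ℤ₃ˣ` (so `t₀ = 0`)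
  have h3Q3 : (((3 : ℚ) ^ m : ℚ) : ℚ_[3]) ≠ 0 := by exact_mod_cast h3Q
  obtain ⟨s, hsdef⟩ : ∃ s : ℚ_[3], s = s₀ * ((((3 : ℚ) ^ m : ℚ) : ℚ_[3]))⁻¹ := ⟨_, rfl⟩
  have hs' : s ^ 2 = (r₃ : ℚ_[3]) := by
    have e : (r₃ : ℚ_[3]) = (r : ℚ_[3]) * (((((3 : ℚ) ^ m : ℚ) : ℚ_[3]))⁻¹) ^ 2 := by
      rw [hr₃r, Rat.cast_mul, Rat.cast_pow]; field_simp
    rw [e, hsdef, mul_pow, hs₀]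
  have hr₃3 : (r₃ : ℚ_[3]) ≠ 0 := by
    rw [hr₃def]; push_cast; exact div_ne_zero hr3 (zpow_ne_zero _ (by norm_num))
  have hs0 : s ≠ 0 := fun h0 => hr₃3 (by rw [← hs', h0, zero_pow two_ne_zero])
  have hns1 : ‖s‖ = 1 := by
    have hw : ‖s‖ = (3 : ℝ) ^ (-s.valuation) := by exact_mod_cast Padic.norm_eq_zpow_neg_valuation hs0
    have h3 : ‖(3 : ℚ_[3])‖ = (3 : ℝ)⁻¹ := by simpa using Padic.norm_p (p := 3)
    have hsq2 : ‖s‖ ^ 2 = (3 : ℝ) ^ (-(t₀ : ℤ)) := by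
      rw [← norm_pow, hs', hr₃, norm_mul, norm_pow, hr₀, mul_one, h3, inv_pow, ← zpow_natCast, ← zpow_neg]
    rw [hw, ← zpow_natCast, ← zpow_mul, zpow_right_inj₀ (by norm_num) (by norm_num)] at hsq2
    have hv0 : s.valuation = 0 := by push_cast at hsq2; omega
    rw [hw, hv0, neg_zero, zpow_zero]
  -- §2 the components over `ℚ`: `Θ = Θ′ + Y·Θ‴`
  obtain ⟨β, hβ⟩ : ∃ β : ℚ, β = (3 * X₀ ^ 2 + (shortModel W D.c).a₄) / (2 * r) := ⟨_, rfl⟩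
  obtain ⟨F₂, hF₂⟩ : ∃ F₂ : ℚ⟦X⟧, F₂ = (shortModel W D.c).formalXMulSq.subst z * z - X₀ • z ^ 3 := ⟨_, rfl⟩
  obtain ⟨Θ', hΘ'⟩ : ∃ Θ' : ℚ⟦X⟧, Θ' = (shortModel W D.c).formalYMulCube.subst z := ⟨_, rfl⟩
  obtain ⟨Θ''', hΘ'''⟩ : ∃ Θ''' : ℚ⟦X⟧, Θ''' = -C ((3 : ℚ) ^ m) * (z ^ 3 + C β * F₂) := ⟨_, rfl⟩
  have hα : tangentSlopeC W D.c X₀ Y₀ = (β : ℂ) * Y₀ := by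
    rw [tangentSlopeC, hβ]
    push_cast
    rw [← hY₀sq]
    field_simp
  have hΘeq : kummerCubeSeriesC W D.c X₀ Y₀ z =
      PowerSeries.map (algebraMap ℚ ℂ) Θ' + C Y * PowerSeries.map (algebraMap ℚ ℂ) Θ''' := by
    rw [kummerCubeSeriesC, hα, hΘ', hΘ''', hF₂, hY₀Y]
    simp only [map_sub, map_add, map_mul, map_neg, map_pow, PowerSeries.map_C, smul_eq_C_mul, eq_ratCast]
    ring
  have hΘ'0 : constantCoeff Θ' = -1 := by
    have hY : (shortModel W D.c).formalYMulCube = -(shortModel W D.c).formalXMulSq := rfl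
    have hzs : HasSubst z := HasSubst.of_constantCoeff_zero' hz.1
    rw [hΘ', hY, ← coe_substAlgHom hzs, map_neg, coe_substAlgHom hzs, map_neg,
      constantCoeff_formalXMulSq_subst (E := shortModel W D.c) hz.1]
  have hΘ'''0 : constantCoeff Θ''' = 0 := by
    rw [hΘ''', hF₂]
    simp only [map_mul, map_neg, map_add, map_sub, map_pow, constantCoeff_C, hz.1, smul_eq_C_mul]
    ring
  -- §3 a cube root over `k₀ = ℚ[ω]/(ω² = r₃)` (binomial series), read in components `u, v ∈ ℚ⟦X⟧` (P1), and `h := u + Y·v` over `ℂ`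
  obtain ⟨Θk, hΘk⟩ : ∃ Θk : (QuadraticAlgebra ℚ r₃ 0)⟦X⟧, Θk = PowerSeries.map (algebraMap ℚ (QuadraticAlgebra ℚ r₃ 0)) Θ' +
      C (ω : QuadraticAlgebra ℚ r₃ 0) * PowerSeries.map (algebraMap ℚ (QuadraticAlgebra ℚ r₃ 0)) Θ''' := ⟨_, rfl⟩
  have hΘk0 : constantCoeff Θk = -1 := by
    rw [hΘk, ← coeff_zero_eq_constantCoeff_apply, coeff_comb, coeff_zero_eq_constantCoeff_apply, coeff_zero_eq_constantCoeff_apply,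
      hΘ'0, hΘ'''0]
    ext <;> simp
  -- (the binomial-series cube root, as in p3's `CubeRootComponents.exists_cubeRoot_of_constantCoeff_eq_neg_one'`)
  obtain ⟨hk, hhk3, hhk0⟩ : ∃ hk : (QuadraticAlgebra ℚ r₃ 0)⟦X⟧, hk ^ 3 = Θk ∧ constantCoeff hk = -1 := by
    obtain ⟨Yk, hYk⟩ : ∃ Yk : (QuadraticAlgebra ℚ r₃ 0)⟦X⟧, Yk = -(Θk + 1) := ⟨_, rfl⟩
    have hY0 : constantCoeff Yk = 0 := by rw [hYk, map_neg, map_add, hΘk0, map_one]; ring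
    have hYs : HasSubst Yk := HasSubst.of_constantCoeff_zero' hY0
    have hcube : PowerSeries.binomialSeries (QuadraticAlgebra ℚ r₃ 0) (1 / 3 : ℚ) ^ 3 = 1 + X := by
      have h13 : (1 : ℚ) = 1 / 3 + 1 / 3 + 1 / 3 := by norm_num
      have hb := PowerSeries.binomialSeries_nat (R := ℚ) (A := QuadraticAlgebra ℚ r₃ 0) 1
      rw [Nat.cast_one, pow_one, h13, PowerSeries.binomialSeries_add, PowerSeries.binomialSeries_add] at hb
      rw [← hb]; ring
    have hg3 : ((PowerSeries.binomialSeries (QuadraticAlgebra ℚ r₃ 0) (1 / 3 : ℚ)).subst Yk) ^ 3 = 1 + Yk := by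
      rw [← coe_substAlgHom hYs, ← map_pow, hcube, map_add, map_one, coe_substAlgHom hYs, subst_X hYs]
    have hg0 : constantCoeff ((PowerSeries.binomialSeries (QuadraticAlgebra ℚ r₃ 0) (1 / 3 : ℚ)).subst Yk) = 1 := by
      rw [Literature.RingTheory.FormalGroups.constantCoeff_subst_of_constantCoeff_eq_zero hY0, PowerSeries.binomialSeries_constantCoeff]
    refine ⟨-(PowerSeries.binomialSeries (QuadraticAlgebra ℚ r₃ 0) (1 / 3 : ℚ)).subst Yk, ?_, ?_⟩
    · rw [neg_pow, hg3, hYk]; ring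
    · rw [map_neg, hg0]
  obtain ⟨u, hu⟩ : ∃ u : ℚ⟦X⟧, u = PowerSeries.mk fun n ↦ (coeff n hk).re := ⟨_, rfl⟩
  obtain ⟨v, hv⟩ : ∃ v : ℚ⟦X⟧, v = PowerSeries.mk fun n ↦ (coeff n hk).im := ⟨_, rfl⟩
  have hkuv : PowerSeries.map (algebraMap ℚ (QuadraticAlgebra ℚ r₃ 0)) u +
      C (ω : QuadraticAlgebra ℚ r₃ 0) * PowerSeries.map (algebraMap ℚ (QuadraticAlgebra ℚ r₃ 0)) v = hk := by
    rw [hu, hv]; exact comb_reS_imS hk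
  have hcomp : u ^ 3 + 3 * C r₃ * u * v ^ 2 = Θ' ∧ 3 * u ^ 2 * v + C r₃ * v ^ 3 = Θ''' := by
    apply comb_injective (K := ℚ) (r := r₃)
    rw [← comb_pow_three, hkuv, hhk3, hΘk]
  have hu0 : constantCoeff u = -1 := by
    rw [← coeff_zero_eq_constantCoeff_apply, hu, coeff_mk, coeff_zero_eq_constantCoeff_apply, hhk0]; simp
  have hv0 : constantCoeff v = 0 := by
    rw [← coeff_zero_eq_constantCoeff_apply, hv, coeff_mk, coeff_zero_eq_constantCoeff_apply, hhk0]; simp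
  obtain ⟨h, huv⟩ : ∃ h : ℂ⟦X⟧, h = PowerSeries.map (algebraMap ℚ ℂ) u + C Y * PowerSeries.map (algebraMap ℚ ℂ) v := ⟨_, rfl⟩
  have hh3 : h ^ 3 = kummerCubeSeriesC W D.c X₀ Y₀ z := by
    have hC : (C Y : ℂ⟦X⟧) ^ 2 = PowerSeries.map (algebraMap ℚ ℂ) (C r₃) := by
      rw [← map_pow, hYsq, PowerSeries.map_C, eq_ratCast]
    rw [hΘeq, huv, ← hcomp.1, ← hcomp.2]
    simp only [map_add, map_mul, map_pow, map_ofNat]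
    rw [← hC]
    ring
  have hh0 : constantCoeff h = -1 := by
    rw [huv, map_add, map_mul, constantCoeff_C, ← coeff_zero_eq_constantCoeff_apply, coeff_map, coeff_zero_eq_constantCoeff_apply, hu0,
      ← coeff_zero_eq_constantCoeff_apply (PowerSeries.map _ v), coeff_map, coeff_zero_eq_constantCoeff_apply, hv0]
    simp
  refine ⟨h, hh3, hh0, ?_⟩
  -- §4 the `3`-adic transport (P2) and the `3`-adic data of P3
  obtain ⟨V, hEll, t, hEa₁, hEa₂, hEa₃, hEa₄, hEa₆, ht0, htne, htint, hDne, hDt, hXc, hYc⟩ :=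
    exists_threeAdic_transport W D a ha h9 z hz h3c
  haveI := hEll
  have hc0 : D.c ≠ 0 := D.maninConstant_ne_zero_holds
  have hcQ : (D.c : ℚ) ≠ 0 := Int.cast_ne_zero.mpr hc0
  have hc3 : ((D.c : ℚ) : ℚ_[3]) ≠ 0 := by exact_mod_cast hcQ
  obtain ⟨ι, hι⟩ : ∃ ι : ℚ⟦X⟧ →+* ℚ_[3]⟦X⟧, ι = PowerSeries.map (algebraMap ℚ ℚ_[3]) := ⟨_, rfl⟩
  rw [← hι] at hDt hXc hYc
  have hrat : ∀ q : ℚ, algebraMap ℚ ℚ_[3] q = (q : ℚ_[3]) := fun q => by rw [eq_ratCast]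
  have hιC : ∀ q : ℚ, ι (C q) = C (q : ℚ_[3]) := fun q => by rw [hι, PowerSeries.map_C, hrat]
  obtain ⟨D₃, hD₃⟩ : ∃ D₃ : ℚ_[3]⟦X⟧, D₃ = ((V.map PadicInt.Coe.ringHom).formalMul 3).subst t := ⟨_, rfl⟩
  rw [← hD₃] at hDne hDt hXc hYc
  obtain ⟨XD, hXD⟩ : ∃ XD : ℚ_[3]⟦X⟧, XD = (V.map PadicInt.Coe.ringHom).formalXMulSq.subst D₃ := ⟨_, rfl⟩
  rw [← hXD] at hXc hYc
  have hιz : ι z = C (((D.c : ℚ) : ℚ_[3])⁻¹) * D₃ := by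
    rw [hDt, ← mul_assoc, ← map_mul, inv_mul_cancel₀ hc3, map_one, one_mul]
  -- the rational scalars `X₁ = X₀/c²`, `y = 3^m/c³`, `ℓ = 3^m β/c`
  obtain ⟨X₁, hX₁⟩ : ∃ X₁ : ℚ, X₁ = X₀ / (D.c : ℚ) ^ 2 := ⟨_, rfl⟩
  obtain ⟨y, hy⟩ : ∃ y : ℚ, y = (3 : ℚ) ^ m / (D.c : ℚ) ^ 3 := ⟨_, rfl⟩
  obtain ⟨ℓ, hℓ⟩ : ∃ ℓ : ℚ, ℓ = (3 : ℚ) ^ m * β / (D.c : ℚ) := ⟨_, rfl⟩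
  have ha₄c : (shortModel W D.c).a₄ = (D.c : ℚ) ^ 4 * (shortModel W 1).a₄ := by
    simp only [shortModel, Int.cast_one, one_pow, one_mul]; ring
  have ha₆c : (shortModel W D.c).a₆ = (D.c : ℚ) ^ 6 * (shortModel W 1).a₆ := by
    simp only [shortModel, Int.cast_one, one_pow, one_mul]; ring
  have hy0 : (y : ℚ_[3]) ≠ 0 := by
    rw [hy]; push_cast
    exact div_ne_zero (zpow_ne_zero m (by norm_num)) (pow_ne_zero 3 (by exact_mod_cast hc0))
  have heq : (y : ℚ_[3]) ^ 2 * (r₃ : ℚ_[3]) =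
      (X₁ : ℚ_[3]) ^ 3 + (V.map PadicInt.Coe.ringHom).a₄ * (X₁ : ℚ_[3]) + (V.map PadicInt.Coe.ringHom).a₆ := by
    rw [hEa₄, hEa₆]
    have e : y ^ 2 * r₃ = X₁ ^ 3 + (shortModel W 1).a₄ * X₁ + (shortModel W 1).a₆ := by
      have hr' : y ^ 2 * r₃ = r / (D.c : ℚ) ^ 6 := by
        rw [hy, hr₃r]; ring
      rw [hr', hrdef, ha₄c, ha₆c, hX₁]
      field_simp
    have h := congrArg (fun q : ℚ => (q : ℚ_[3])) e
    push_cast at h ⊢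
    linear_combination h
  have hψ : (V.map PadicInt.Coe.ringHom).Ψ₃.eval (X₁ : ℚ_[3]) = 0 := by
    have hΨc := (isRoot_Ψ₃_shortModel_iff W D.c X₀).mp hT.2
    have hΨ1 : 3 * X₁ ^ 4 + 6 * (shortModel W 1).a₄ * X₁ ^ 2 + 12 * (shortModel W 1).a₆ * X₁ - (shortModel W 1).a₄ ^ 2 = 0 := by
      rw [ha₄c, ha₆c] at hΨc
      rw [hX₁]
      field_simp
      linear_combination hΨc
    rw [WeierstrassCurve.Ψ₃]
    simp only [WeierstrassCurve.b₂, WeierstrassCurve.b₄, WeierstrassCurve.b₆, WeierstrassCurve.b₈, Polynomial.eval_add,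
      Polynomial.eval_mul, Polynomial.eval_pow, Polynomial.eval_C, Polynomial.eval_X, Polynomial.eval_ofNat,
      hEa₁, hEa₂, hEa₃, hEa₄, hEa₆]
    have h := congrArg (fun q : ℚ => (q : ℚ_[3])) hΨ1
    push_cast at h ⊢
    linear_combination h
  have hℓeq : (ℓ : ℚ_[3]) * (2 * (y : ℚ_[3]) * (r₃ : ℚ_[3])) = 3 * (X₁ : ℚ_[3]) ^ 2 + (V.map PadicInt.Coe.ringHom).a₄ := by
    rw [hEa₄]
    have e : ℓ * (2 * y * r₃) = 3 * X₁ ^ 2 + (shortModel W 1).a₄ := by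
      have e1 : ℓ * (2 * y * r₃) = 2 * β * r / (D.c : ℚ) ^ 4 := by
        rw [hℓ, hy, hr₃r]; ring
      have e2 : 2 * β * r = 3 * X₀ ^ 2 + (shortModel W D.c).a₄ := by
        rw [hβ, mul_div_assoc', div_mul_eq_mul_div, div_eq_iff (mul_ne_zero two_ne_zero hr0)]; ring
      rw [e1, e2, ha₄c, hX₁]
      field_simp
    have h := congrArg (fun q : ℚ => (q : ℚ_[3])) e
    push_cast at h ⊢
    linear_combination h
  -- the series `P = ι Θ′`, `Q = ι Θ‴` read on `E♮ ⊗ ℚ₃`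
  have hιF₂ : ι F₂ = XD * (C (((D.c : ℚ) : ℚ_[3])⁻¹) * D₃) - C ((X₀ : ℚ) : ℚ_[3]) * (C (((D.c : ℚ) : ℚ_[3])⁻¹) * D₃) ^ 3 := by
    rw [hF₂, map_sub, map_mul, smul_eq_C_mul, map_mul, map_pow, hXc, hιz, hιC]
  have hP : ι Θ' = -XD := by rw [hΘ']; exact hYc
  have hQ : ι Θ''' = -C (y : ℚ_[3]) * D₃ ^ 3 - C (ℓ : ℚ_[3]) * (XD * D₃ - C (X₁ : ℚ_[3]) * D₃ ^ 3) := by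
    rw [hΘ''', map_mul, map_neg, map_add, map_mul, map_pow, hιF₂, hιz, hιC, hιC, hy, hℓ, hX₁]
    have e1 : (C ((((3 : ℚ) ^ m / (D.c : ℚ) ^ 3 : ℚ)) : ℚ_[3]) : ℚ_[3]⟦X⟧) =
        C (((3 : ℚ) ^ m : ℚ) : ℚ_[3]) * C (((D.c : ℚ) : ℚ_[3])⁻¹) ^ 3 := by
      rw [← map_pow, ← map_mul]; congr 1; push_cast; ring
    have e2 : (C ((((3 : ℚ) ^ m * β / (D.c : ℚ) : ℚ)) : ℚ_[3]) : ℚ_[3]⟦X⟧) =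
        C (((3 : ℚ) ^ m : ℚ) : ℚ_[3]) * C ((β : ℚ_[3])) * C (((D.c : ℚ) : ℚ_[3])⁻¹) := by
      rw [← map_mul, ← map_mul]; congr 1; push_cast; ring
    have e3 : (C (((X₀ / (D.c : ℚ) ^ 2 : ℚ)) : ℚ_[3]) : ℚ_[3]⟦X⟧) = C ((X₀ : ℚ_[3])) * C (((D.c : ℚ) : ℚ_[3])⁻¹) ^ 2 := by
      rw [← map_pow, ← map_mul]; congr 1; push_cast; ring
    rw [e1, e2, e3]
    ring
  -- boundedness: `D₃`, `x̂(D₃)` are integral; the rational scalars need a power of `3`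
  have hD₃int : IsPadicInt D₃ := by
    rw [hD₃, ← map_formalMul]
    exact (isPadicInt_map _).powerSeries_subst htint (HasSubst.of_constantCoeff_zero' ht0)
  have hD₃0 : constantCoeff D₃ = 0 := by
    rw [hD₃, Literature.RingTheory.FormalGroups.constantCoeff_subst_of_constantCoeff_eq_zero ht0, constantCoeff_formalMul]
  have hXDint : IsPadicInt XD := by
    rw [hXD, ← map_formalXMulSq]
    exact (isPadicInt_map _).powerSeries_subst hD₃int (HasSubst.of_constantCoeff_zero' hD₃0)
  obtain ⟨K₀, hKy, hKℓ, hKℓX⟩ :=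
    exists_norm_pow_mul_le_one₃ (p := 3) (y : ℚ_[3]) (ℓ : ℚ_[3]) ((ℓ : ℚ_[3]) * (X₁ : ℚ_[3]))
  simp only [Nat.cast_ofNat] at hKy hKℓ hKℓX
  have h3Kint : IsPadicInt (C ((3 : ℚ_[3]) ^ K₀) : ℚ_[3]⟦X⟧) :=
    IsPadicInt.powerSeries_C (by rw [norm_pow]; exact pow_le_one₀ (norm_nonneg _) h3n.le)
  have hPint : IsPadicInt (C ((3 : ℚ_[3]) ^ K₀) * ι Θ') := by rw [hP]; exact h3Kint.mul hXDint.neg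
  have hQint : IsPadicInt (C ((3 : ℚ_[3]) ^ K₀) * ι Θ''') := by
    rw [hQ]
    have e : C ((3 : ℚ_[3]) ^ K₀) * (-C (y : ℚ_[3]) * D₃ ^ 3 - C (ℓ : ℚ_[3]) * (XD * D₃ - C (X₁ : ℚ_[3]) * D₃ ^ 3)) =
        -C ((3 : ℚ_[3]) ^ K₀ * (y : ℚ_[3])) * D₃ ^ 3 - C ((3 : ℚ_[3]) ^ K₀ * (ℓ : ℚ_[3])) * (XD * D₃)
          + C ((3 : ℚ_[3]) ^ K₀ * ((ℓ : ℚ_[3]) * (X₁ : ℚ_[3]))) * D₃ ^ 3 := by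
      simp only [map_mul]; ring
    rw [e]
    exact ((((IsPadicInt.powerSeries_C hKy).neg.mul (hD₃int.pow 3)).sub
      ((IsPadicInt.powerSeries_C hKℓ).mul (hXDint.mul hD₃int))).add ((IsPadicInt.powerSeries_C hKℓX).mul (hD₃int.pow 3)))
  -- the component identities over `ℚ₃`
  have hU : (ι u) ^ 3 + 3 * C (r₃ : ℚ_[3]) * ι u * (ι v) ^ 2 = ι Θ' := by
    rw [← hcomp.1]; simp only [map_add, map_mul, map_pow, map_ofNat, hιC]
  have hV : 3 * (ι u) ^ 2 * ι v + C (r₃ : ℚ_[3]) * (ι v) ^ 3 = ι Θ''' := by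
    rw [← hcomp.2]; simp only [map_add, map_mul, map_pow, map_ofNat, hιC]
  -- §5 the `3`-adic core, split case (P5)
  have hP' : ι Θ' = -(V.map PadicInt.Coe.ringHom).formalXMulSq.subst (((V.map PadicInt.Coe.ringHom).formalMul 3).subst t) := by
    rw [hP, hXD, hD₃]
  have hQ' : ι Θ''' = -C (y : ℚ_[3]) * ((V.map PadicInt.Coe.ringHom).formalMul 3).subst t ^ 3
      - C (ℓ : ℚ_[3]) * ((V.map PadicInt.Coe.ringHom).formalXMulSq.subst (((V.map PadicInt.Coe.ringHom).formalMul 3).subst t)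
          * ((V.map PadicInt.Coe.ringHom).formalMul 3).subst t - C (X₁ : ℚ_[3]) * ((V.map PadicInt.Coe.ringHom).formalMul 3).subst t ^ 3) := by
    rw [hQ, hXD, hD₃]
  have hDne' : ((V.map PadicInt.Coe.ringHom).formalMul 3).subst t ≠ 0 := hD₃ ▸ hDne
  obtain ⟨K, hKu, hKv⟩ := components_threeAdicallyBounded_split V hEa₁ hEa₂ hEa₃ ht0 htne htint hDne' hs' hns1 hy0 heq hψ hℓeq
    hP' hQ' hU hV hPint hQint
  -- §6 algebraic integrality of `M·3^K·(uₙ + Y vₙ)`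
  have hden₃ : ¬ (3 ∣ r₃.den) := by
    refine not_dvd_den_of_norm_ratCast_le_one (p := 3) ?_
    rw [hr₃, norm_mul, norm_pow, hr₀, mul_one]
    exact pow_le_one₀ (norm_nonneg _) h3n.le
  have hint : ∀ k : ℤ, IsIntegral ℤ (k : ℂ) := fun k =>
    ⟨Polynomial.X - Polynomial.C k, Polynomial.monic_X_sub_C k, by simp⟩
  have hYint : IsIntegral ℤ ((r₃.den : ℂ) * Y) := by
    refine MinimalThreeTorsionC.isIntegral_of_monic_quadratic 0 (-(r₃.den * r₃.num : ℤ)) ?_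
    have hd : (r₃.den : ℂ) ≠ 0 := by exact_mod_cast r₃.den_nz
    have hnd : (r₃ : ℂ) = (r₃.num : ℂ) / (r₃.den : ℂ) := by exact_mod_cast (Rat.num_div_den r₃).symm
    push_cast
    rw [mul_pow, hYsq, hnd]
    field_simp
    ring
  have hcast : ∀ q : ℚ, (3 : ℚ_[3]) ^ K * (q : ℚ_[3]) = ((3 ^ K * q : ℚ) : ℚ_[3]) := fun q => by push_cast; ring
  have hcoef : ∀ n, coeff n h = ((coeff n u : ℚ) : ℂ) + Y * ((coeff n v : ℚ) : ℂ) := fun n => by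
    rw [huv, map_add, coeff_map, coeff_C_mul, coeff_map, eq_ratCast, eq_ratCast]
  unfold IsThreeAdicallyBoundedAlg
  refine ⟨K, fun n => ?_⟩
  have hun := (isPadicInt_iff_coeff.mp hKu) n
  have hvn := (isPadicInt_iff_coeff.mp hKv) n
  rw [coeff_C_mul, hι, coeff_map, hrat, hcast] at hun hvn
  have hdu := not_dvd_den_of_norm_ratCast_le_one (p := 3) hun
  have hdv := not_dvd_den_of_norm_ratCast_le_one (p := 3) hvn
  have hnum : ∀ q : ℚ, IsIntegral ℤ (((q.den * q : ℚ)) : ℂ) := fun q => by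
    rw [Rat.den_mul_eq_num, Rat.cast_intCast]; exact hint _
  refine ⟨(3 ^ K * coeff n u).den * (3 ^ K * coeff n v).den * r₃.den, fun h3 => ?_, ?_⟩
  · rcases (Nat.Prime.dvd_mul Nat.prime_three).mp h3 with h12 | h3'
    · rcases (Nat.Prime.dvd_mul Nat.prime_three).mp h12 with h1 | h2
      · exact hdu h1
      · exact hdv h2
    · exact hden₃ h3'
  · have e : (((3 ^ K * coeff n u).den * (3 ^ K * coeff n v).den * r₃.den : ℕ) : ℂ) * (3 : ℂ) ^ K * coeff n h =
        (((3 ^ K * coeff n v).den * r₃.den : ℕ) : ℂ) * ((((3 ^ K * coeff n u).den * (3 ^ K * coeff n u) : ℚ)) : ℂ)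
          + (((3 ^ K * coeff n u).den : ℕ) : ℂ) * ((((3 ^ K * coeff n v).den * (3 ^ K * coeff n v) : ℚ)) : ℂ)
            * ((r₃.den : ℂ) * Y) := by
      rw [hcoef]; push_cast; ring
    rw [e]
    have hnat : ∀ k : ℕ, IsIntegral ℤ (k : ℂ) := fun k => by exact_mod_cast hint k
    exact ((hnat _).mul (hnum _)).add (((hnat _).mul (hnum _)).mul hYint)

/-- **(BI)_K HOLDS** (`UDCKummerLineK.KummerCubeRootThreeBoundedK`, -an g39): by cases on «`Y₀²` is a square in `ℚ₃`» — this file's split case and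
P4's `kummerCubeRootThreeBoundedK_of_not_isSquare_padic` (p739974).  KLINE, RES₃♭, C3 and BSD are NOT proved by this. [cite: Honda1970, Thm. 2 (p. 223)] -/
theorem kummerCubeRootThreeBoundedK_holds : KummerCubeRootThreeBoundedK := by
  intro W _ _ N _ D a ha h9 X₀ Y₀ hT z hz h3c
  by_cases hsq : ∃ s₀ : ℚ_[3], s₀ ^ 2 = ((X₀ ^ 3 + (shortModel W D.c).a₄ * X₀ + (shortModel W D.c).a₆ : ℚ) : ℚ_[3])
  · exact kummerCubeRootThreeBoundedK_of_isSquare_padic W D a ha h9 X₀ Y₀ hT z hz h3c hsq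
  · exact kummerCubeRootThreeBoundedK_of_not_isSquare_padic W D a ha h9 X₀ Y₀ hT z hz h3c fun s₀ h ↦ hsq ⟨s₀, h⟩

/-- **The C3 LEAD's v30 stub (BI)_K, verbatim header.** [folklore] -/
theorem stub_kummerCubeRootThreeBoundedK : KummerCubeRootThreeBoundedK :=
  kummerCubeRootThreeBoundedK_holds

end Summit.BirchSwinnertonDyer.BirchSwinnertonDyer.Theorems.ManinLocalTwoThree.KLineBI

end
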